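import Summits.QuantumFields.YangMills.Theorems.BalabanUVNodesN10B13KernelTowerWalksEntrywiseNumeralsDecoratedDialsLocatedVolDials
import Literature.MathematicalPhysics.QuantumFieldTheory.Balaban1983to89.Node00.CarriersB13BondTower

/-!
# BalabanUVNodes ∕ N10 — THE JUNCTION OF RECORD REDUCED TO NUMERICS AT THE BOND TOWER: 67VL (`…DialsLocatedVolDials`, = the junction of record 67V with its
# volume binder located) applied at the bond-indexed object tower `Node00.bondTower θ n k m₃ c g R` of `CarriersB13BondTower`, with EVERY object ∕ size ∕
# measurability ∕ (1.33)-family binder DISCHARGED by the tower's named theorems — what remains displayed is the NUMERICS half of the joint inhabitant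
# (Track A, DAG node N10 [B13]; D-0149 width seat `pub-ymgap-dag-n10-w3` g4; own-stem successor of p618083 (S7 bond tower) and p619692 (67VL))

WHY (lane census v18 item 3, ref-K g14's SECOND-GAP l.31932 «67V's dial-weighted binders' JOINT inhabitation at a tree constants family»).  The joint inhabitant of the
junction of record splits into (a) an object tower, (b) a numerics family, (c) the application.  (a) is `Node00.bondTower` (p618083): every object ∕ size binder of
67V ∕ 67VL holds at it by a named theorem.  THIS FILE is (c) MODULO (b): it APPLIES 67VL at the tower — `K = K′ = θ₁ = K₂ = 0`, `m₂ = 0`, `α = 0`, `R = 3ε₁`,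
`m = m_F = 1`, `c₀ = 0`, `r_C = 0`, `m′ = 4(m₃+1)⁴`, `V = 4((m₃+1)(ℓ₆+1))⁴`, `dist := M·side`, `ιb := val`, `cube :=` the fine cube of the initial site — so that
of 67VL's 142 binders only the NUMERICAL ones stay displayed: the sizes' threshold `hN12`, the constants' signs ∕ thresholds, the Lemma-3 numerics `hN` AT THE RECORD's
(ODD) BLOCK SIZE `L = θ.ℓ₆ + 1` (`Lemma3Numerics ({c with L := θ.ℓ₆+1}) (m₃+1) (L∕2) …`), `h12`, `hτ2`, `cp ∕ hκp`, the rung at ONE admissible reference package `rf`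
(with the tower's located margins: `rf.m₀ ≤ 4`, `rf.Rσ ≤ R+1`, `1 ≤ rf.nB`, `1 ≤ rf.dm`), NODE A's budget and floor, the (2.24)–(2.26) numerals `hγle hM4`, p. 17's
`a ≤ γ₂·r_P²` read as `a ≤ γ₂·(ε₁∕‖g‖)²`, `g ≠ 0`, `4 ≤ B_Δ`, and the FOUR DIAL INEQUALITIES of the located volume binder.  Conclusion `B13LeafOfRecord θ
(bondTower θ n k m₃ c g R).toC.toK.layer` BY NAME.  So THE JOINT INHABITANT OF THE N10 JUNCTION OF RECORD ≡ ONE ∃-STATEMENT ABOUT REAL LETTERS (the hypothesis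
list of this theorem) — and `CarriersB13BondTower` §5 locates what it takes: a constants family at the record's ODD `L ≥ 9` (`c13OfRecord_L_ne_eight`; every
typed witness family has `L = 8`), re-dialled for the volume inequalities (HANDOFF of the seat).

HONEST FRAMING.  Count-neutral kernel bookkeeping BY NAME over LANDED modules (67VL + the bond tower); the object data are the A6 MODEL of p618083 (finite matrices
on a one-dimensional site torus — NOT Bałaban's `Δ_k`, NOT NODE 00's reading); the numerical hypotheses are NOT discharged here and their joint satisfiability at
an odd-L family is OPEN (located); nothing of Bałaban's asserted; N10 NOT discharged; K1⁸ NOT claimed; counts unmoved; one finite four-torus programme at fixed ε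
per run; nothing continuum ∕ ℝ⁴ ∕ OS ∕ mass-gap ∕ Clay.  0 `sorry`, 0 `def`, standard axioms.  Filed `--kind proof --supports` K1⁸ «StabilityBRunRowsAtRecordR13SepCoPH»
(stmt-QuantumFields-26907) `--as helper` of route «BalabanUVNodes» (dag-lead GATE v1.65 key map).

WHAT THIS FILE PROVES.  §1 `hC_at_zero`, `hfloor_at_zero` (the (1.36) ∕ (2.41)-type constant inequalities at vanishing prefactors); ★★★
`b13LeafOfRecord_bondTower_of_numerics`.  Proof: the package's signed letters (`R₁⋆ > 0`, `K̄ ≥ 0` for `hαloc` at `α = 0`; `M₁ > 0` for `hc₀`), then 67VL positionally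
(117 explicit arguments: 60 tower theorems ∕ vacuity closures, 57 numerical hypotheses passed through).

References (TYPES and page anchors only): [II] = [Balaban1988RG2Cluster] Lemma 1 p.9, Lemma 2 p.11, Lemma 3 p.20, (2.3) p.12, (2.5)–(2.8) pp.12–14, (2.14)–(2.26) pp.15–17,
p.20 (before (2.37)), p.21; [I] = [Balaban1987RG1] p.253, (1.11)–(1.14) p.262; [B9] = [Balaban1985BackgroundPropagators] Thm 3.10 (3.107)–(3.108) p.416, Thm 3.12 p.423.
A2 ∕ A6.  The displayed numerical hypotheses are EXACTLY the output shape of this seat's `B13ChainJointNonvacuityPrefactorsBond.junction_numerals_joint_witness_of_activity_bond`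
(at `L = 8`) plus the four dial inequalities and the tower margins — jointly inhabited there at `L = 8`, `θ₀ := θ₀max`; at the record's odd `L` and small dials their
joint inhabitation is the open numerics item (b), not claimed.
-/

noncomputable section

namespace Summit.QuantumFields.YangMills.BalabanUVNodes.N10B13BondTowerReduced

open Literature.MathematicalPhysics.QuantumFieldTheory.Balaban1983to89
open Literature.MathematicalPhysics.QuantumFieldTheory.Balaban1983to89.DagBinding
open Literature.MathematicalPhysics.QuantumFieldTheory.Balaban1983to89.Node00
open Literature.MathematicalPhysics.QuantumFieldTheory.Balaban1983to89.B13Lemma3TorusSocket (Lemma3Numerics)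
open Literature.MathematicalPhysics.QuantumFieldTheory.Balaban1983to89.B12TreeDecay (kappa₀ K₀ K₀_pos)
open Literature.MathematicalPhysics.QuantumFieldTheory.Balaban1983to89.B13Bound143 (invTau R12)
open Literature.MathematicalPhysics.QuantumFieldTheory.Balaban1983to89.NodeOLettersOfWalksAcross (WalkPackage)
open Literature.MathematicalPhysics.QuantumFieldTheory.Balaban1983to89.NodeOLettersOfWalksPerturbative (RefPackage)
open Literature.MathematicalPhysics.QuantumFieldTheory.Balaban1983to89.B13Bound226Numerals (theta0Max gamma2Max m4Min coefQ coefQ' dSum)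
open Literature.MathematicalPhysics.QuantumFieldTheory.Balaban1983to89.B13EntrywiseBlockNumerals (kbarFloor)
open Literature.MathematicalPhysics.QuantumFieldTheory.Balaban1983to89.B13RungDialNumerals (radiusStar alphaMax rsigmaMin radiusStar_pos alphaMax_pos)
open Literature.MathematicalPhysics.QuantumFieldTheory.Balaban1983to89.NodeOLettersOfWalksAcross.WalkPackage (Kbar_nonneg)
open Literature.MathematicalPhysics.QuantumFieldTheory.Balaban1983to89.NodeOLettersOfWalksPerturbative.RefPackage (admissible_toWalkPackage cV_nonneg cV₀_nonneg)
open Summit.QuantumFields.YangMills.BalabanUVNodes.N10B13KernelTowerWalksEntrywiseNumeralsDecoratedDialsLocatedVolDials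
  (b13LeafOfRecord_decLayer_of_located_entrywise_numerals_dials_located_volDials)

/-! ## §1. The two constant inequalities at vanishing prefactors -/

/-- The (1.36) constant inequality `hC` at `K = K′ = θ₁ = 0` reads `0 ≤ E₀ε₁C₁M^q e^{C₂κ₁}`. [cite: Balaban1988RG2Cluster, (1.36) p.9 (degenerate data)] -/
theorem hC_at_zero (c : B13.Consts) (L : ℕ) (hE : 0 < c.E₀) (hε : 0 < c.ε₁) (hC₁ : 0 < c.C₁) (hM : 1 ≤ c.M) :
    (0 : ℝ) * K₀ 64 8 * (2 * (6 * ((L : ℕ) : ℝ)) ^ 4) * Real.exp 1 * Real.exp ((1 / 8) * c.κ₁ * (12 ^ 4 - 1)) +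
        2 * (64 * (0 : ℝ)) * K₀ 64 8 * 1344 ≤
      (1 - (0 : ℝ)) * (c.E₀ * c.ε₁ * c.C₁ * c.M ^ c.q * Real.exp (c.C₂ * c.κ₁)) := by
  have hMq : 0 < c.M ^ c.q := pow_pos (by linarith) _
  have : (0 : ℝ) * K₀ 64 8 * (2 * (6 * ((L : ℕ) : ℝ)) ^ 4) * Real.exp 1 * Real.exp ((1 / 8) * c.κ₁ * (12 ^ 4 - 1)) +
      2 * (64 * (0 : ℝ)) * K₀ 64 8 * 1344 = 0 := by ring
  rw [this, sub_zero, one_mul]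
  positivity

/-- The (2.41)-type floor `hfloor` at `m₂ = 0`, `K₂ = 0` reads `0 ≤ C₃M⁴e^{C₂κ₁}`. [cite: Balaban1988RG2Cluster, p.21 (after (2.41)) (degenerate data)] -/
theorem hfloor_at_zero (c : B13.Consts) (hC₃ : 0 ≤ c.C₃) (hM : 1 ≤ c.M) :
    27 * ((0 : ℕ) : ℝ) * (0 : ℝ) * Real.exp (c.κ₁ - 1) ≤ c.C₃ * c.M ^ 4 * Real.exp (c.C₂ * c.κ₁) := by
  have hM4 : 0 ≤ c.M ^ 4 := by positivity
  have : 27 * ((0 : ℕ) : ℝ) * (0 : ℝ) * Real.exp (c.κ₁ - 1) = 0 := by simp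
  rw [this]
  exact mul_nonneg (mul_nonneg hC₃ hM4) (Real.exp_pos _).le

/-! ## §2. The junction of record at the bond tower, objects discharged -/

section Reduced

variable (θ : Stage3Params) (n k m₃ : ℕ) (c : B13.Consts) (g : ℂ) (R : ℕ)

-- the junction elaborates ≈ 150 binders and a 120-argument application; twice the default budget (as the source junctions)
set_option maxHeartbeats 400000 in
open Classical in
/-- ★★★ **THE [B13] LEAF OF RECORD AT THE BOND TOWER, FROM NUMERICS ALONE.**  67VL (`b13LeafOfRecord_decLayer_of_located_entrywise_numerals_dials_located_volDials`)
at `lamD := Node00.bondTower θ n k m₃ c g R` with every object ∕ size ∕ measurability ∕ empty-family binder discharged by `CarriersB13BondTower`'s theorems; displayed: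
the constants' signs and thresholds, `hN` at the record's ODD block size, `h12`, `hτ2`, `cp`, the rung letters at `rf` (+ the tower's margins `m₀ ≤ 4`, `R_σ ≤ R+1`,
`1 ≤ n_B`, `1 ≤ d_m`), NODE A's budget ∕ floor (`ν = m_F = 1`, `c₀ = r_C = 0`), `hγle hM4` (`m = 1`, `m′ = 4(m₃+1)⁴`), `a ≤ γ₂(ε₁∕‖g‖)²`, `g ≠ 0`, `4 ≤ B_Δ`, and the
four dial inequalities at `V = 4((m₃+1)(ℓ₆+1))⁴`.  The joint inhabitant of the junction of record is thereby ONE ∃-statement over these real letters.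
[cite: Balaban1988RG2Cluster, Lemma 1 p.9, Lemma 2 p.11, Lemma 3 p.20, (2.3) p.12, (2.14)–(2.26) pp.15–17, p.20 (before (2.37)), p.21;
Balaban1987RG1, p.253, (1.11)–(1.14) p.262; Balaban1985BackgroundPropagators, Thm 3.10 (3.107)–(3.108) p.416, Thm 3.12 p.423] -/
theorem b13LeafOfRecord_bondTower_of_numerics
    (hN12 : 12 ≤ (θ.ℓ₆ + 1) * (n + 1)) (hL8 : 8 ≤ θ.ℓ₆ + 1)
    -- the constants' signs and thresholds (Lemma 1 ∕ 2)
    (hκ : 0 ≤ c.κ) (hδ1 : c.δ < 1) (hδκ : 1 ≤ c.δ * c.κ) (hκ126 : kappa₀ 64 8 ≤ c.κ) (hκ126' : kappa₀ 64 8 ≤ c.δ * c.κ)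
    (hκ₁ : 1 + 2 * Real.log (8 * 12 ^ 3) ≤ c.κ₁) (hκ₁' : 2 + 16 * Real.log 128 ≤ c.κ₁)
    (hδ₀ : 0 ≤ c.δ₀) (hM0 : 0 ≤ c.M) (hδ₀M : 10 * Real.exp (-1) ≤ c.δ₀ * c.M) (hδ₀M5 : 2 * Real.log 5 ≤ c.δ₀ * c.M)
    (hR8 : (1 - c.δ) * c.κ ≤ (1 / 4) * (c.κ₁ - 1)) (hR9 : (1 - 2 * c.δ) * c.κ ≤ (1 / 16) * c.κ₁) (hC₃ : 0 ≤ c.C₃)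
    -- Lemma 3's numerics AT THE RECORD's ODD BLOCK SIZE, (2.18), R12, signs
    {a a₂ a₂' a₅ Aabs : ℝ}
    (hN : Lemma3Numerics ({ c with L := θ.ℓ₆ + 1 } : B13.Consts) (m₃ + 1) (((θ.ℓ₆ + 1 : ℕ) : ℝ) / 2) a a₂ a₂' a₅ Aabs)
    (h12 : R12 ({ c with L := θ.ℓ₆ + 1 } : B13.Consts)) (hE : 0 < c.E₀) (hε : 0 < c.ε₁) (hC₁ : 0 < c.C₁) (hα : 0 < c.α₄) (hM : 1 ≤ c.M)
    (hτ2 : c.E₀ * c.ε₁ * c.C₁ * c.α₄⁻¹ * c.M ^ c.q * Real.exp (c.C₂ * c.κ₁) ≤ 1 / 2)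
    (cp : B13.Consts) (hκp : c.κ₁ < cp.κ₁) (hg : g ≠ 0) {γ₂ : ℝ} (hγ₂ : 0 ≤ γ₂)
    -- the rung at ONE admissible reference package, radius located, exchange letter free, and the tower's margins
    (rf : RefPackage) (hrf : rf.Admissible) {R₁ : ℝ} (hR₁def : R₁ = radiusStar rf.R rf.m₀ rf.mA₀ rf.KbarP rf.KbarA rf.cV rf.cV₀)
    (hp : (rf.toWalkPackage R₁).PositiveRates) (hη : rf.η ≤ (rf.toWalkPackage R₁).etaMax)
    {θ₀ : ℝ} (hθ₀ : 0 < θ₀)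
    (hθle : θ₀ ≤ theta0Max 1 1 (rf.toWalkPackage R₁).kapCStar (rf.toWalkPackage R₁).Kbar (8 / rf.mA₀) (2 / rf.mA₀)
      (rf.toWalkPackage R₁).BΓ rf.cV (B6.c0 1 rf.η) rf.mA₀)
    (hRσloc : rsigmaMin θ₀ (rf.toWalkPackage R₁).Kbar (rf.toWalkPackage R₁).mu (rf.toWalkPackage R₁).kapCStar rf.m₀ rf.mA₀ rf.KbarP rf.KbarA
      rf.cV rf.cV₀ rf.εP rf.εA ≤ rf.Rσ)
    (hm04 : rf.m₀ ≤ 4) (hRσR : rf.Rσ ≤ (R : ℝ) + 1) (hnB1 : 1 ≤ rf.nB) (hdm1 : 1 ≤ rf.dm)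
    (hεL : rf.εL ≤ rf.εP) (hκL : rf.kapL ≤ rf.kapP) (hKL : rf.KbarP ≤ rf.KbarL) (hεA : rf.εA ≤ rf.εP)
    (hκA : rf.kapA ≤ rf.kapP) (hKA : rf.KbarP ≤ rf.KbarA) (hmA : rf.mA₀ ≤ rf.m₀)
    -- NODE A: entry bound of the constant fluctuation operator, rate, slope, junction rate, budget, floor (`ν = m_F = 1`, `c₀ = r_C = 0`)
    {ρΔ BΔ ηΔ μΔ M₁ : ℝ} (hB4 : 4 ≤ BΔ)
    (hηΔ : 0 < ηΔ) (hP2 : 2 * cp.κ₁ ≤ ηΔ * M₁) (hμΔ : 0 < μΔ)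
    (hbudget : ηΔ + rf.εP + rf.kapP + 4 * μΔ ≤ ρΔ)
    (hkbar : kbarFloor 1 1 0 ρΔ ηΔ μΔ 0 cp.κ₁ BΔ ≤ rf.KbarP)
    -- the (2.24)–(2.25) located numerals at `m = 1`, `ν = 1`, `m′ = 4(m₃+1)⁴`, and p. 17's coupling
    (hγle : γ₂ ≤ gamma2Max 1 1 (2 / rf.mA₀) (rf.toWalkPackage R₁).BΓ rf.cV (B6.c0 1 rf.η) rf.mA₀)
    (hM4 : m4Min 1 1 (4 * (m₃ + 1) ^ 4) (2 / rf.mA₀) (rf.toWalkPackage R₁).BΓ rf.cV (B6.c0 1 rf.η) rf.mA₀ c.α₄ c.κ₁ ≤ c.M ^ 4)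
    (hPa : a ≤ γ₂ * (c.ε₁ / ‖g‖) ^ 2)
    -- the located volume binder: four product-form dial inequalities at `V = 4((m₃+1)(ℓ₆+1))⁴`
    (hθvol : 4 * (4 * ((((m₃ + 1 : ℕ) : ℝ) * ((θ.ℓ₆ + 1 : ℕ) : ℝ)) ^ 4)) * (3 * coefQ 1 1 (rf.toWalkPackage R₁).kapCStar (rf.toWalkPackage R₁).Kbar (8 / rf.mA₀)
        + 2 * (dSum 1 1 (2 / rf.mA₀) (rf.toWalkPackage R₁).BΓ rf.cV (B6.c0 1 rf.η) rf.mA₀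
          * coefQ' 1 1 (rf.toWalkPackage R₁).kapCStar (rf.toWalkPackage R₁).Kbar (8 / rf.mA₀))) * θ₀ ≤ a₅)
    (hγvol : 8 * (4 * ((((m₃ + 1 : ℕ) : ℝ) * ((θ.ℓ₆ + 1 : ℕ) : ℝ)) ^ 4)) * dSum 1 1 (2 / rf.mA₀) (rf.toWalkPackage R₁).BΓ rf.cV (B6.c0 1 rf.η) rf.mA₀ * γ₂ ≤ a₅)
    (hαM : 8 * (4 * ((((m₃ + 1 : ℕ) : ℝ) * ((θ.ℓ₆ + 1 : ℕ) : ℝ)) ^ 4)) * dSum 1 1 (2 / rf.mA₀) (rf.toWalkPackage R₁).BΓ rf.cV (B6.c0 1 rf.η) rf.mA₀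
        * (2 * ((((4 * (m₃ + 1) ^ 4 : ℕ)) : ℝ) * c.α₄ * (c.M ^ 4)⁻¹ * (1 + 32 / (c.κ₁ - 1)) ^ 4)) ≤ a₅)
    (hαK : 8 * (4 * ((((m₃ + 1 : ℕ) : ℝ) * ((θ.ℓ₆ + 1 : ℕ) : ℝ)) ^ 4)) * (K₀ 64 8 * c.α₄) ≤ a₅) :
    B13LeafOfRecord θ (bondTower θ n k m₃ c g R).toC.toK.layer := by
  -- the package's signed letters: `R₁⋆ > 0`, `K̄ ≥ 0` (for `hαloc` at `α = 0`), and the slope `M₁ > 0` (for `hc₀`)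
  have hR₁pos : 0 < R₁ := hR₁def ▸ radiusStar_pos hrf.hR hrf.hm₀ hrf.hmA₀ hrf.hKbarP hrf.hKbarA (cV_nonneg hrf) (cV₀_nonneg hrf)
  have hKbar : 0 ≤ (rf.toWalkPackage R₁).Kbar := Kbar_nonneg (admissible_toWalkPackage hrf hR₁pos)
  have hM₁0 : 0 ≤ M₁ := by
    have hlog : 0 < Real.log (8 * 12 ^ 3) := Real.log_pos (by norm_num)
    have hpos : 0 < ηΔ * M₁ := by linarith only [hP2, hκp, hκ₁, hlog]
    exact (pos_of_mul_pos_right hpos hηΔ.le).le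
  exact b13LeafOfRecord_decLayer_of_located_entrywise_numerals_dials_located_volDials θ (bondTower θ n k m₃ c g R)
    hN12
    (bondDist θ n k c)
    (fun Y a ha => (Finset.notMem_empty a ha).elim)
    (fun Y a => Finset.empty_subset _)
    (fun Y a ha => (Finset.notMem_empty a ha).elim)
    (fun Y => Finset.empty_subset _)
    (bondTower_hdist0 θ n k c hδ₀ hM0)
    (bondTower_hdist θ n k c hδ₀ hM0)
    (fun Y a j q => Finset.empty_subset _)
    (fun Y a j q => Finset.empty_subset _)
    (fun Y a ha => (Finset.notMem_empty a ha).elim)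
    (fun Y a ha => (Finset.notMem_empty a ha).elim)
    (fun Y a ha => (Finset.notMem_empty a ha).elim)
    le_rfl
    le_rfl
    hκ
    hδ1
    hδκ
    hκ126
    hκ126'
    hκ₁
    hκ₁'
    hδ₀M
    hδ₀M5
    hR8
    hR9
    (fun Y φ _ a ha => (Finset.notMem_empty a ha).elim)
    (fun Y φ _ a ha => (Finset.notMem_empty a ha).elim)
    le_rfl
    zero_lt_one
    (hC_at_zero c (θ.ℓ₆ + 1) hE hε hC₁ hM)
    (bondTower_hGlAn θ n k m₃ c g R)
    (bondTower_hGl θ n k m₃ c g R le_rfl hE hε hC₁ hM)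
    (bondTower_he θ n k m₃ c g R)
    hg
    le_rfl
    (mul_pos (by norm_num) hε)
    le_rfl
    (fun Y i hi => (Finset.notMem_empty i hi).elim)
    (fun Y i hi => (Finset.notMem_empty i hi).elim)
    (bondTower_hcard θ n k m₃ c g R 0)
    (bondTower_hsp θ n k m₃ c g R hε)
    (hfloor_at_zero c hC₃ hM)
    (fun Y i hi => (Finset.notMem_empty i hi).elim)
    (bondTower_hG θ n k m₃ c g R)
    hL8
    hN
    h12
    hE
    hε
    hC₁
    hα
    hM
    hτ2
    cp
    hκp
    one_pos
    le_rfl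
    le_rfl
    (bondTower_huα θ n k m₃ c g R le_rfl)
    (bondTower_hPcard θ n k m₃ c g R)
    (bondIota θ n k m₃ c g R)
    (bondTower_hι θ n k m₃ c g R)
    (bondCube θ n k m₃ c g R)
    (bondTower_hQsupp θ n k m₃ c g R)
    (bondTower_hfibc θ n k m₃ c g R)
    (bondTower_hBv θ n k m₃ c g R)
    (bondTower_hBv0 θ n k m₃ c g R)
    (bondTower_hχsupp θ n k m₃ c g R)
    (bondTower_hVm θ n k m₃ c g R)
    (bondTower_hsmallm θ n k m₃ c g R)
    hγ₂
    (bondTower_locNFibreMax_le_one θ n k m₃ c g R)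
    rf
    hrf
    hR₁def
    hp
    hη
    hθ₀
    hθle
    (alphaMax_pos hθ₀ hR₁pos hKbar).le
    hRσloc
    (bondTower_hKX θ n k m₃ c g R)
    (bondTower_hEL θ n k m₃ c g R hB4)
    (bondTower_locFFibreMax_le_one θ n k m₃ c g R)
    (bondTower_hsymm θ n k m₃ c g R)
    (bondTower_hthrough θ n k m₃ c g R)
    (bondTower_decorExcess_le θ n k m₃ c g R hM₁0 0)
    hηΔ
    hP2
    (bondTower_cmAbsMax_le_one θ n k m₃ c g R)
    (bondTower_cmRange_le θ n k m₃ c g R (le_refl (0 : ℝ)))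
    hμΔ
    hbudget
    hkbar
    (bondTower_le_accretiveFloorMax θ n k m₃ c g R hm04)
    (hRσR.trans (bondTower_le_sigmaDistFloor θ n k m₃ c g R))
    ((bondTower_locNFibreMax_le_one θ n k m₃ c g R).trans hnB1)
    hdm1
    hεL
    hκL
    hKL
    hεA
    hκA
    hKA
    hmA
    hγle
    hM4
    hPa
    (by positivity)
    (bondTower_card_Λ_le θ n k m₃ c g R)
    (bondTower_card_sum_le θ n k m₃ c g R)
    (bondTower_card_biUnion_le θ n k m₃ c g R)
    hθvol
    hγvol
    hαM
    hαK

end Reduced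

end Summit.QuantumFields.YangMills.BalabanUVNodes.N10B13BondTowerReduced

end
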